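import Mathlib
import Summits.PneNP.PneNP.Theorems.SliceTarget.Negative.LoadBearing
import Summits.PneNP.PneNP.Theorems.OneSliceBandImpliesThreshold

/-!
# COMBINED FILE — split `SliceTarget ⟸ MonotoneContinuation ∧ SingleThreshold` (crux stmt-PneNP-2832)

Concatenation (imports merged) of the three Theorems-ready files
`OneSliceSliceTargetSplitTransport.lean` (part I, transport kernel) · `OneSliceSliceTargetSplitStability.lean`
(part II, CLIQUE stability) · `OneSliceSliceTargetSplit.lean` (part III, read-back + assembly), so that the whole
assembly elaborates standalone against the tree (parts II–III import part I, which a planner cannot land: Theorems is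
prover-only). Final theorems (namespace `Summit.PneNP.PneNP.Theorems.SliceTargetSplit`):
`sliceTarget_of_schedule_of_singleThreshold : MonotoneContinuationSchedule → SingleThreshold → SliceTarget` and
`sliceTarget_of_monotoneContinuation_of_singleThreshold : MonotoneContinuation → SingleThreshold → SliceTarget`
(0 sorries, axioms {propext, Classical.choice, Quot.sound}). Strategist planner-cstrat-stmt-PneNP-2832-r1-0, 2026-08-17.
-/

/-!
# Route OneSlice, crux `SliceTarget` (stmt-PneNP-2832) — split `SliceTarget ⟸ MonotoneContinuation ∧ SingleThreshold`,
# part I: the slice transport kernel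

The canonical TRANSPORT of a function `g` living on the Hamming slice `j` of the edge cube of `K_n` to an
arbitrary edge vector `y`: the average of `g` over the slice-`j` vectors COMPARABLE with `y` (`x ⊆ y` or
`y ⊆ x` as edge sets). This file proves the two structural facts the split's assembly uses:

* `card_nbhd` — the number of slice-`j` vectors comparable with a vector of weight `i` is
  `D(N,i,j) = C(i,j)` (`j ≤ i`) resp. `C(N-i, j-i)` (`i ≤ j`), and the reciprocity
  `C(N,i)·D(N,i,j) = C(N,j)·D(N,j,i)` (`choose_mul_nbhdCard`);
* `sum_gnpWeight_transport_le` — transporting a nonnegative `g` and integrating against `G(n,p)` gives at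
  most the slice average of `g` (the kernel maps `G(n,p)` — indeed every slice law — onto the uniform law of
  slice `j`); whence the `L¹(G(n,p))`-CONTRACTION `l1_transport_le`:
  `‖T g − T h‖_{L¹(G(n,p))} ≤ (1/#slice_j) Σ_{x ∈ slice j} |g x − h x|`.

Vocabulary: `Edge`, `slice` (ConstantBand lane), `supp` (SliceACZero lane), `gnpWeight` (Literature).
Strategist seat planner-cstrat-stmt-PneNP-2832-r1-0, 2026-08-17.
-/

set_option linter.dupNamespace false -- `Summit.PneNP.PneNP.…`: summit = sub-problem (D-0017)

namespace Summit.PneNP.PneNP.Theorems.SliceTargetSplit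

open Literature.Computability.Complexity hiding supp mem_supp
open Finset hiding slice
open Filter hiding mem_sdiff
open Classical
open Summit.PneNP.PneNP.Theorems.ConstantBand.Negative (Edge slice)
open Summit.PneNP.PneNP.Theorems.SliceACZero.Negative (supp mem_supp card_supp supp_injective
  supp_indicator)

noncomputable section

variable {n : ℕ}

/-! ### Comparability, neighbourhoods, transport -/

/-- Comparability of two edge vectors: one edge set contains the other. [folklore] -/
def Comp (x y : Edge n → Bool) : Prop :=
  (∀ e, x e = true → y e = true) ∨ (∀ e, y e = true → x e = true)

/-- Comparability is symmetric. [folklore] -/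
theorem comp_comm {x y : Edge n → Bool} : Comp x y ↔ Comp y x := Or.comm

/-- Comparability through supports. [folklore] -/
theorem comp_iff_supp {x y : Edge n → Bool} : Comp x y ↔ supp x ⊆ supp y ∨ supp y ⊆ supp x := by
  simp only [Comp, Finset.subset_iff, mem_supp]

/-- The slice-`j` vectors comparable with `y`. [folklore] -/
def nbhd (j : ℕ) (y : Edge n → Bool) : Finset (Edge n → Bool) :=
  (slice n j).filter fun x => Comp x y

/-- Membership in a neighbourhood. [folklore] -/
theorem mem_nbhd {j : ℕ} {y x : Edge n → Bool} : x ∈ nbhd j y ↔ edgeCount x = j ∧ Comp x y := by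
  simp only [nbhd, slice, mem_filter, mem_univ, true_and]

/-- **Transport** of a real function on slice `j` to the vector `y`: its average over the slice-`j`
vectors comparable with `y` (junk `0` when there is none). [folklore] -/
def transport (j : ℕ) (g : (Edge n → Bool) → ℝ) (y : Edge n → Bool) : ℝ :=
  (∑ x ∈ nbhd j y, g x) / #(nbhd j y)

/-- The real indicator of a Boolean function. [folklore] -/
def ind (f : (Edge n → Bool) → Bool) (x : Edge n → Bool) : ℝ := if f x = true then 1 else 0

/-- The `L¹(G(n,p))` distance of two real functions on the edge cube (a finite weighted sum). [folklore] -/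
def l1 (n : ℕ) (p : ℝ) (u v : (Edge n → Bool) → ℝ) : ℝ := ∑ y, gnpWeight n p y * |u y - v y|

/-- The neighbourhood size function `D(N,i,j)`. [folklore] -/
def nbhdCard (N i j : ℕ) : ℕ := if j ≤ i then i.choose j else (N - i).choose (j - i)

/-! ### Indicators and `l1` bookkeeping -/

theorem ind_nonneg (f : (Edge n → Bool) → Bool) (x : Edge n → Bool) : 0 ≤ ind f x := by
  unfold ind; split_ifs <;> norm_num

theorem ind_le_one (f : (Edge n → Bool) → Bool) (x : Edge n → Bool) : ind f x ≤ 1 := by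
  unfold ind; split_ifs <;> norm_num

/-- `|𝟙[f x] − 𝟙[g x]| = 𝟙[f x ≠ g x]`. [folklore] -/
theorem abs_ind_sub_ind (f g : (Edge n → Bool) → Bool) (x : Edge n → Bool) :
    |ind f x - ind g x| = if f x ≠ g x then 1 else 0 := by
  unfold ind
  cases f x <;> cases g x <;> simp

theorem l1_comm (p : ℝ) (u v : (Edge n → Bool) → ℝ) : l1 n p u v = l1 n p v u := by
  unfold l1; exact sum_congr rfl fun y _ => by rw [abs_sub_comm]

theorem l1_nonneg {p : ℝ} (hp0 : 0 ≤ p) (hp1 : p ≤ 1) (u v : (Edge n → Bool) → ℝ) : 0 ≤ l1 n p u v :=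
  sum_nonneg fun y _ => mul_nonneg (gnpWeight_nonneg hp0 hp1 y) (abs_nonneg _)

/-- Triangle inequality for `l1`. [folklore] -/
theorem l1_triangle {p : ℝ} (hp0 : 0 ≤ p) (hp1 : p ≤ 1) (u v w : (Edge n → Bool) → ℝ) :
    l1 n p u w ≤ l1 n p u v + l1 n p v w := by
  unfold l1
  rw [← sum_add_distrib]
  refine sum_le_sum fun y _ => ?_
  rw [← mul_add]
  exact mul_le_mul_of_nonneg_left (abs_sub_le _ _ _) (gnpWeight_nonneg hp0 hp1 y)

/-- The `l1` distance of two indicators is the `G(n,p)`-probability of disagreement. [folklore] -/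
theorem l1_ind_ind (p : ℝ) (f g : (Edge n → Bool) → Bool) :
    l1 n p (ind f) (ind g) = gnpProb n p (univ.filter fun x => f x ≠ g x) := by
  unfold l1 gnpProb
  rw [sum_filter]
  refine sum_congr rfl fun y _ => ?_
  rw [abs_ind_sub_ind]
  split_ifs <;> simp

/-- `l1` regrouped by edge count. [folklore] -/
theorem l1_eq_sum_slices (p : ℝ) (u v : (Edge n → Bool) → ℝ) :
    l1 n p u v = ∑ i ∈ range (n.choose 2 + 1),
      p ^ i * (1 - p) ^ (n.choose 2 - i) * ∑ y ∈ slice n i, |u y - v y| := by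
  unfold l1
  rw [← sum_fiberwise_of_maps_to (g := edgeCount) (t := range (n.choose 2 + 1)) (s := univ)]
  · refine sum_congr rfl fun i _ => ?_
    rw [mul_sum]
    refine sum_congr rfl fun y hy => ?_
    rw [gnpWeight, (mem_filter.1 hy).2]
  · intro x _
    rw [mem_range, Nat.lt_succ_iff, edgeCount, ← card_edgeSet_top_fin n, ← card_univ]
    exact card_filter_le _ _

/-! ### Supports and comparability -/

/-- Comparable vectors with the smaller weight on the left are nested on the left. [folklore] -/
theorem supp_subset_of_comp_of_le {x y : Edge n → Bool} (h : Comp x y) (hle : edgeCount x ≤ edgeCount y) :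
    supp x ⊆ supp y := by
  rcases comp_iff_supp.1 h with h | h
  · exact h
  · rw [← card_supp, ← card_supp] at hle
    exact (Finset.eq_of_subset_of_card_le h hle).symm.subset

/-- The indicator vector of an edge set. [folklore] -/
def ofSet (s : Finset (Edge n)) : Edge n → Bool := fun e => decide (e ∈ s)

theorem supp_ofSet (s : Finset (Edge n)) : supp (ofSet s) = s := supp_indicator s

theorem ofSet_supp (x : Edge n → Bool) : ofSet (supp x) = x :=
  supp_injective (supp_ofSet _)

theorem edgeCount_ofSet (s : Finset (Edge n)) : edgeCount (ofSet s) = #s := by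
  rw [← card_supp, supp_ofSet]

/-! ### Neighbourhood sizes -/

/-- Downward neighbourhoods: for `j ≤ e(y)`, the slice-`j` vectors comparable with `y` are the `j`-subsets of
its support, `C(e(y), j)` of them. [folklore] -/
theorem card_nbhd_of_le {j : ℕ} {y : Edge n → Bool} (hj : j ≤ edgeCount y) :
    #(nbhd j y) = (edgeCount y).choose j := by
  rw [← card_supp, ← card_powersetCard]
  refine card_nbij' supp ofSet ?_ ?_ ?_ ?_
  · intro x hx
    rw [mem_coe, mem_nbhd] at hx
    rw [mem_coe, mem_powersetCard]
    refine ⟨supp_subset_of_comp_of_le hx.2 (hx.1 ▸ hj), ?_⟩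
    rw [card_supp, hx.1]
  · intro s hs
    rw [mem_coe, mem_powersetCard] at hs
    rw [mem_coe, mem_nbhd]
    refine ⟨by rw [edgeCount_ofSet, hs.2], comp_iff_supp.2 (Or.inl ?_)⟩
    rw [supp_ofSet]; exact hs.1
  · intro x _; exact ofSet_supp x
  · intro s _; exact supp_ofSet s

/-- Upward neighbourhoods: for `e(y) ≤ j`, the slice-`j` vectors comparable with `y` are the supersets of its
support of size `j`, `C(N - e(y), j - e(y))` of them. [folklore] -/
theorem card_nbhd_of_ge {j : ℕ} {y : Edge n → Bool} (hj : edgeCount y ≤ j) :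
    #(nbhd j y) = (n.choose 2 - edgeCount y).choose (j - edgeCount y) := by
  have hc : #(univ \ supp y) = n.choose 2 - edgeCount y := by
    rw [card_sdiff_of_subset (subset_univ _), card_univ, card_edgeSet_top_fin, card_supp]
  rw [← hc, ← card_powersetCard]
  refine card_nbij' (fun x => supp x \ supp y) (fun t => ofSet (supp y ∪ t)) ?_ ?_ ?_ ?_
  · intro x hx
    rw [mem_coe, mem_nbhd] at hx
    have hyx : supp y ⊆ supp x := supp_subset_of_comp_of_le (comp_comm.1 hx.2) (hx.1 ▸ hj)
    rw [mem_coe, mem_powersetCard]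
    refine ⟨sdiff_subset_sdiff (subset_univ _) le_rfl, ?_⟩
    rw [card_sdiff_of_subset hyx, card_supp, card_supp, hx.1]
  · intro t ht
    rw [mem_coe, mem_powersetCard] at ht
    have hdisj : Disjoint (supp y) t := by
      rw [Finset.disjoint_left]
      intro e he het
      have := ht.1 het
      rw [mem_sdiff] at this
      exact this.2 he
    rw [mem_coe, mem_nbhd]
    refine ⟨?_, comp_iff_supp.2 (Or.inr ?_)⟩
    · rw [edgeCount_ofSet, card_union_of_disjoint hdisj, card_supp, ht.2]
      omega
    · rw [supp_ofSet]; exact subset_union_left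
  · intro x hx
    rw [mem_coe, mem_nbhd] at hx
    have hyx : supp y ⊆ supp x := supp_subset_of_comp_of_le (comp_comm.1 hx.2) (hx.1 ▸ hj)
    change ofSet (supp y ∪ (supp x \ supp y)) = x
    rw [union_sdiff_of_subset hyx, ofSet_supp]
  · intro t ht
    rw [mem_coe, mem_powersetCard] at ht
    change supp (ofSet (supp y ∪ t)) \ supp y = t
    rw [supp_ofSet, union_sdiff_left, Finset.sdiff_eq_self_iff_disjoint]
    rw [Finset.disjoint_left]
    intro e het he
    have := ht.1 het
    rw [mem_sdiff] at this
    exact this.2 he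

/-- **Neighbourhood sizes.** A vector of weight `i` has exactly `D(N,i,j)` slice-`j` vectors comparable with
it. [folklore] -/
theorem card_nbhd {i j : ℕ} {y : Edge n → Bool} (hy : edgeCount y = i) : #(nbhd j y) = nbhdCard (n.choose 2) i j := by
  unfold nbhdCard
  split_ifs with h
  · rw [card_nbhd_of_le (hy ▸ h), hy]
  · rw [card_nbhd_of_ge (by rw [hy]; omega), hy]

/-- **Reciprocity** `C(N,i)·D(N,i,j) = C(N,j)·D(N,j,i)` (both count the comparable pairs between the slices
`i` and `j`). [folklore] -/
theorem choose_mul_nbhdCard (N i j : ℕ) : N.choose i * nbhdCard N i j = N.choose j * nbhdCard N j i := by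
  unfold nbhdCard
  rcases le_or_gt j i with hji | hij
  · rw [if_pos hji]
    rcases hji.eq_or_lt with rfl | hlt
    · simp
    · rw [if_neg (not_le.2 hlt)]
      exact Nat.choose_mul (n := N) hji
  · rw [if_neg (not_le.2 hij), if_pos hij.le]
    exact (Nat.choose_mul (n := N) hij.le).symm

/-- Neighbourhoods inside the cube are nonempty: `D(N,i,j) > 0` for `i, j ≤ N`. [folklore] -/
theorem nbhdCard_pos {N i j : ℕ} (hi : i ≤ N) (hj : j ≤ N) : 0 < nbhdCard N i j := by
  unfold nbhdCard
  split_ifs with h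
  · exact Nat.choose_pos h
  · exact Nat.choose_pos (by omega)

/-! ### Double counting and the contraction -/

/-- **Double counting of comparable pairs** between the slices `i` and `j`, with a weight depending on both
ends. [folklore] -/
theorem sum_slice_sum_nbhd (i j : ℕ) (F : (Edge n → Bool) → (Edge n → Bool) → ℝ) :
    ∑ y ∈ slice n i, ∑ x ∈ nbhd j y, F x y = ∑ x ∈ slice n j, ∑ y ∈ nbhd i x, F x y := by
  unfold nbhd
  simp_rw [sum_filter]
  rw [sum_comm]
  refine sum_congr rfl fun x _ => sum_congr rfl fun y _ => ?_
  simp only [comp_comm]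

/-- Summing a function of the slice-`j` end over all comparable pairs: each `x ∈ slice j` is counted
`D(N,j,i)` times. [folklore] -/
theorem sum_slice_sum_nbhd_left (i j : ℕ) (G : (Edge n → Bool) → ℝ) :
    ∑ y ∈ slice n i, ∑ x ∈ nbhd j y, G x = (nbhdCard (n.choose 2) j i : ℝ) * ∑ x ∈ slice n j, G x := by
  rw [sum_slice_sum_nbhd i j (fun x _ => G x), mul_sum]
  refine sum_congr rfl fun x hx => ?_
  rw [sum_const, nsmul_eq_mul, card_nbhd (mem_filter.1 hx).2]

/-- The transport of a nonnegative function is nonnegative. [folklore] -/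
theorem transport_nonneg {j : ℕ} {g : (Edge n → Bool) → ℝ} (hg : ∀ x, 0 ≤ g x) (y : Edge n → Bool) :
    0 ≤ transport j g y :=
  div_nonneg (sum_nonneg fun x _ => hg x) (Nat.cast_nonneg _)

/-- Transport is linear: differences. [folklore] -/
theorem transport_sub (j : ℕ) (g h : (Edge n → Bool) → ℝ) (y : Edge n → Bool) :
    transport j g y - transport j h y = transport j (fun x => g x - h x) y := by
  unfold transport
  rw [sum_sub_distrib, sub_div]

/-- `|T g| ≤ T |g|`. [folklore] -/
theorem abs_transport_le (j : ℕ) (g : (Edge n → Bool) → ℝ) (y : Edge n → Bool) :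
    |transport j g y| ≤ transport j (fun x => |g x|) y := by
  unfold transport
  rw [abs_div, Nat.abs_cast]
  exact div_le_div_of_nonneg_right (abs_sum_le_sum_abs _ _) (Nat.cast_nonneg _)

/-- **The kernel maps `G(n,p)` below the uniform law of slice `j`**: for nonnegative `g`,
`Σ_y w_p(y)·(T g)(y) ≤ (1/#slice_j)·Σ_{x ∈ slice j} g x` (`0 ≤ p ≤ 1`; equality unless `j > C(n,2)`, where
both sides vanish). [folklore] -/
theorem sum_gnpWeight_transport_le {p : ℝ} (hp0 : 0 ≤ p) (hp1 : p ≤ 1) (j : ℕ) {g : (Edge n → Bool) → ℝ}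
    (hg : ∀ x, 0 ≤ g x) :
    ∑ y, gnpWeight n p y * transport j g y ≤ (∑ x ∈ slice n j, g x) / #(slice n j) := by
  set S : ℝ := ∑ x ∈ slice n j, g x with hS
  have hS0 : 0 ≤ S := sum_nonneg fun x _ => hg x
  -- regroup by the weight of `y`
  have hregroup : ∑ y, gnpWeight n p y * transport j g y =
      ∑ i ∈ range ((n.choose 2) + 1), p ^ i * (1 - p) ^ ((n.choose 2) - i) * ∑ y ∈ slice n i, transport j g y := by
    rw [← sum_fiberwise_of_maps_to (g := edgeCount) (t := range ((n.choose 2) + 1)) (s := univ)]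
    · refine sum_congr rfl fun i _ => ?_
      rw [mul_sum]
      refine sum_congr rfl fun y hy => ?_
      rw [gnpWeight, (mem_filter.1 hy).2]
    · intro x _
      rw [mem_range, Nat.lt_succ_iff, edgeCount, ← card_edgeSet_top_fin n, ← card_univ]
      exact card_filter_le _ _
  -- on slice `i` the transport sums to `(D((n.choose 2),j,i)/D((n.choose 2),i,j))·S ≤ (C((n.choose 2),i)/C((n.choose 2),j))·S`
  have hslice : ∀ i ∈ range ((n.choose 2) + 1),
      ∑ y ∈ slice n i, transport j g y ≤ ((n.choose 2).choose i : ℝ) * (S / ((n.choose 2).choose j : ℝ)) := by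
    intro i _
    have hT : ∑ y ∈ slice n i, transport j g y =
        (∑ y ∈ slice n i, ∑ x ∈ nbhd j y, g x) / (nbhdCard (n.choose 2) i j : ℝ) := by
      rw [sum_div]
      refine sum_congr rfl fun y hy => ?_
      rw [transport, card_nbhd (mem_filter.1 hy).2]
    rw [hT, sum_slice_sum_nbhd_left i j g, ← hS]
    have hrec := choose_mul_nbhdCard (n.choose 2) i j
    rcases Nat.eq_zero_or_pos (nbhdCard (n.choose 2) i j) with hD | hD
    · rw [hD, Nat.cast_zero, div_zero]
      exact mul_nonneg (Nat.cast_nonneg _) (div_nonneg hS0 (Nat.cast_nonneg _))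
    rcases Nat.eq_zero_or_pos ((n.choose 2).choose j) with hCj | hCj
    · -- slice `j` is empty: `S = 0`
      have hjN : (n.choose 2) < j := by
        by_contra h; push Not at h; exact absurd hCj (Nat.choose_pos h).ne'
      have hS' : S = 0 := by
        rw [hS]
        refine sum_eq_zero fun x hx => ?_
        exfalso
        have hx' := (mem_filter.1 hx).2
        have : edgeCount x ≤ n.choose 2 := by
          rw [edgeCount, ← card_edgeSet_top_fin n, ← card_univ]; exact card_filter_le _ _
        omega
      rw [hS']; simp
    have hD' : (0 : ℝ) < nbhdCard (n.choose 2) i j := by exact_mod_cast hD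
    have hCj' : (0 : ℝ) < (n.choose 2).choose j := by exact_mod_cast hCj
    have hrec' : ((n.choose 2).choose i : ℝ) * nbhdCard (n.choose 2) i j = (n.choose 2).choose j * nbhdCard (n.choose 2) j i := by exact_mod_cast hrec
    rw [div_le_iff₀ hD']
    calc (nbhdCard (n.choose 2) j i : ℝ) * S = ((n.choose 2).choose j * nbhdCard (n.choose 2) j i) * (S / (n.choose 2).choose j) := by
          field_simp
      _ = ((n.choose 2).choose i : ℝ) * (S / (n.choose 2).choose j) * nbhdCard (n.choose 2) i j := by rw [← hrec']; ring
    exact le_rfl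
  rw [hregroup]
  calc ∑ i ∈ range ((n.choose 2) + 1), p ^ i * (1 - p) ^ ((n.choose 2) - i) * ∑ y ∈ slice n i, transport j g y
      ≤ ∑ i ∈ range ((n.choose 2) + 1), p ^ i * (1 - p) ^ ((n.choose 2) - i) * (((n.choose 2).choose i : ℝ) * (S / ((n.choose 2).choose j : ℝ))) :=
        sum_le_sum fun i hi => mul_le_mul_of_nonneg_left (hslice i hi)
          (mul_nonneg (pow_nonneg hp0 _) (pow_nonneg (sub_nonneg.2 hp1) _))
    _ = (∑ i ∈ range ((n.choose 2) + 1), ((n.choose 2).choose i : ℝ) * p ^ i * (1 - p) ^ ((n.choose 2) - i)) * (S / (n.choose 2).choose j) := by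
        rw [sum_mul]; exact sum_congr rfl fun i _ => by ring
    _ = S / #(slice n j) := by
        rw [binomialWeight_sum_range (b := fun i => ((n.choose 2).choose i : ℝ) * p ^ i * (1 - p) ^ ((n.choose 2) - i))
          (fun i => rfl), one_mul, card_slice]

/-- **The transport kernel is an `L¹(G(n,p))` contraction from the uniform law of slice `j`.** [folklore] -/
theorem l1_transport_le {p : ℝ} (hp0 : 0 ≤ p) (hp1 : p ≤ 1) (j : ℕ) (g h : (Edge n → Bool) → ℝ) :
    l1 n p (transport j g) (transport j h) ≤ (∑ x ∈ slice n j, |g x - h x|) / #(slice n j) := by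
  refine le_trans ?_ (sum_gnpWeight_transport_le hp0 hp1 j (g := fun x => |g x - h x|) fun x => abs_nonneg _)
  unfold l1
  refine sum_le_sum fun y _ => mul_le_mul_of_nonneg_left ?_ (gnpWeight_nonneg hp0 hp1 y)
  rw [transport_sub]
  exact abs_transport_le j _ y

/-- The slice-`j` average distance of two indicators is the counting error fraction. [folklore] -/
theorem sum_slice_abs_ind_sub_ind (j : ℕ) (f g : (Edge n → Bool) → Bool) :
    ∑ x ∈ slice n j, |ind f x - ind g x| = #((slice n j).filter fun x => f x ≠ g x) := by
  rw [← sum_boole]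
  refine sum_congr rfl fun x _ => ?_
  rw [abs_ind_sub_ind]

end

end Summit.PneNP.PneNP.Theorems.SliceTargetSplit


/-!
# Route OneSlice, crux `SliceTarget` (stmt-PneNP-2832) — split `SliceTarget ⟸ MonotoneContinuation ∧ SingleThreshold`,
# part II: `k`-CLIQUE is transport-stable

The clique function survives the slice transport of part I: transporting `𝟙[CLIQUE_k]` from slice `j` to a vector `y`
of weight `i` changes it only if a uniformly random comparable pair `(x, y)` between the slices `j` and `i` separates
"has a `k`-clique" — which requires the random `|i - j|` deleted edges to hit ONE FIXED `k`-clique of the larger vector,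
an event of probability `≤ C(k,2)·|i - j| / max(i,j)` (`sum_card_bad_le`, `sliceSum_transport_clique_le`; no clique
counting is needed). Mixing over the binomial law of `|G(n,p)|` with Chebyshev for the far slices gives the
`L¹(G(n,p))` stability estimate `l1_transport_clique_le`:
`‖T𝟙[CLIQUE_k] − 𝟙[CLIQUE_k]‖ ≤ C(k,2)·W/L + Np(1-p)/t²` whenever the slices within `W` of `j` have weight `≥ L` and
the others are `t`-far from the mean.

Strategist seat planner-cstrat-stmt-PneNP-2832-r1-0, 2026-08-17.
-/

set_option linter.dupNamespace false -- `Summit.PneNP.PneNP.…`: summit = sub-problem (D-0017)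

namespace Summit.PneNP.PneNP.Theorems.SliceTargetSplit

open Literature.Computability.Complexity hiding supp mem_supp
open Finset hiding slice
open Filter hiding mem_sdiff
open Classical
open Summit.PneNP.PneNP.Theorems.ConstantBand.Negative (Edge slice)
open Summit.PneNP.PneNP.Theorems.SliceACZero.Negative (supp mem_supp card_supp supp_injective
  supp_indicator)

noncomputable section

variable {n : ℕ}

/-! ### The transport error of an indicator, pointwise and per slice -/

/-- A transported indicator lies in `[0,1]`. [folklore] -/
theorem transport_ind_mem {j : ℕ} (f : (Edge n → Bool) → Bool) (y : Edge n → Bool) :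
    0 ≤ transport j (ind f) y ∧ transport j (ind f) y ≤ 1 := by
  refine ⟨transport_nonneg (ind_nonneg f) y, ?_⟩
  unfold transport
  rcases Nat.eq_zero_or_pos #(nbhd j y) with h | h
  · rw [h, Nat.cast_zero, div_zero]; exact zero_le_one
  · rw [div_le_one (by exact_mod_cast h)]
    calc ∑ x ∈ nbhd j y, ind f x ≤ ∑ x ∈ nbhd j y, (1 : ℝ) := sum_le_sum fun x _ => ind_le_one f x
      _ = #(nbhd j y) := by rw [sum_const, nsmul_eq_mul, mul_one]

/-- The transport error of an indicator is at most `1` pointwise. [folklore] -/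
theorem abs_transport_ind_sub_ind_le_one {j : ℕ} (f : (Edge n → Bool) → Bool) (y : Edge n → Bool) :
    |transport j (ind f) y - ind f y| ≤ 1 := by
  have h1 := transport_ind_mem (j := j) f y
  have h2 := ind_nonneg f y
  have h3 := ind_le_one f y
  rw [abs_sub_le_iff]; constructor <;> linarith

/-- **Pointwise transport error**: at a vector with a nonempty neighbourhood, `|T𝟙[f](y) − 𝟙[f](y)|` is at most the
fraction of comparable slice-`j` vectors on which `f` differs from `f y`. [folklore] -/
theorem abs_transport_ind_sub_ind_le {j : ℕ} (f : (Edge n → Bool) → Bool) {y : Edge n → Bool}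
    (hD : 0 < #(nbhd j y)) :
    |transport j (ind f) y - ind f y| ≤ (#((nbhd j y).filter fun x => f x ≠ f y) : ℝ) / #(nbhd j y) := by
  have hD' : (0 : ℝ) < #(nbhd j y) := by exact_mod_cast hD
  have hrw : transport j (ind f) y - ind f y = (∑ x ∈ nbhd j y, (ind f x - ind f y)) / #(nbhd j y) := by
    rw [transport, sum_sub_distrib, sum_const, nsmul_eq_mul, sub_div, mul_div_cancel_left₀ _ hD'.ne']
  rw [hrw, abs_div, Nat.abs_cast]
  refine div_le_div_of_nonneg_right ?_ hD'.le
  refine (abs_sum_le_sum_abs _ _).trans ?_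
  rw [← sum_boole]
  refine (sum_le_sum fun x _ => ?_)
  have := abs_ind_sub_ind f (fun _ => f y) x
  simp only [ind] at this ⊢
  rw [this]

/-- **Per-slice transport error** (slices `i, j ≤ C(n,2)`): the slice-`i` sum of the transport error of `𝟙[f]` is at
most the number of separating comparable pairs over `D(N,i,j)`. [folklore] -/
theorem sliceSum_abs_transport_ind_sub_ind_le {i j : ℕ} (f : (Edge n → Bool) → Bool) (hi : i ≤ n.choose 2)
    (hj : j ≤ n.choose 2) :
    ∑ y ∈ slice n i, |transport j (ind f) y - ind f y|
      ≤ (∑ y ∈ slice n i, (#((nbhd j y).filter fun x => f x ≠ f y) : ℝ)) / nbhdCard (n.choose 2) i j := by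
  rw [sum_div]
  refine sum_le_sum fun y hy => ?_
  have hyi : edgeCount y = i := (mem_filter.1 hy).2
  rw [← card_nbhd hyi]
  exact abs_transport_ind_sub_ind_le f (by rw [card_nbhd hyi]; exact nbhdCard_pos hi hj)

/-! ### Separating pairs for `CLIQUE_k`: hit the witnessing clique -/

/-- Nested supports are ordered vectors. [folklore] -/
theorem le_of_supp_subset {x y : Edge n → Bool} (h : supp x ⊆ supp y) : x ≤ y := by
  intro e
  rw [Bool.le_iff_imp]
  intro hx
  exact mem_supp.1 (h (mem_supp.2 hx))

/-- `CLIQUE_k` is monotone along nested supports. [folklore] -/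
theorem cliqueFn_of_supp_subset {k : ℕ} {x y : Edge n → Bool} (h : supp x ⊆ supp y)
    (hx : cliqueFn n k x = true) : cliqueFn n k y = true := by
  have hmono := cliqueFn_monotone_holds n k (le_of_supp_subset h)
  rw [hx] at hmono
  exact top_le_iff.1 hmono

/-- A witnessing clique: `CLIQUE_k(z) = 1` gives a `k`-set `A` with `K_A ⊆ z`. [folklore] -/
theorem exists_cliqueVec_le {k : ℕ} {z : Edge n → Bool} (hz : cliqueFn n k z = true) :
    ∃ A ∈ powersetCard k (univ : Finset (Fin n)), ∀ e, cliqueVec A e = true → z e = true := by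
  have hne := (cliqueCount_ne_zero_iff z).2 hz
  rw [Ne, cliqueCount_eq_zero_iff_forall] at hne
  push Not at hne
  exact hne

/-- Containing `K_A` for a `k`-set `A` forces `CLIQUE_k = 1`. [folklore] -/
theorem cliqueFn_of_cliqueVec_le {k : ℕ} {A : Finset (Fin n)} (hA : A ∈ powersetCard k (univ : Finset (Fin n)))
    {x : Edge n → Bool} (hx : ∀ e, cliqueVec A e = true → x e = true) : cliqueFn n k x = true := by
  have hk : k ≤ #A := (mem_powersetCard.1 hA).2.ge
  refine cliqueFn_of_supp_subset (x := cliqueVec A) ?_ (cliqueFn_cliqueVec hk)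
  intro e he
  exact mem_supp.2 (hx e (mem_supp.1 he))

/-- Slice-`a` vectors below `z` avoiding a fixed on-edge `e` of `z`: at most `C(e(z) - 1, a)`. [folklore] -/
theorem card_nbhd_filter_false_le {a : ℕ} {z : Edge n → Bool} (haz : a ≤ edgeCount z) {e : Edge n}
    (he : z e = true) :
    #((nbhd a z).filter fun x => x e = false) ≤ (edgeCount z - 1).choose a := by
  have hcard : #((supp z).erase e) = edgeCount z - 1 := by
    rw [card_erase_of_mem (mem_supp.2 he), card_supp]
  rw [← hcard, ← card_powersetCard]
  refine card_le_card_of_injOn supp ?_ (supp_injective.injOn)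
  intro x hx
  rw [mem_coe, mem_filter, mem_nbhd] at hx
  obtain ⟨⟨hxa, hcomp⟩, hxe⟩ := hx
  rw [mem_coe, mem_powersetCard]
  refine ⟨?_, by rw [card_supp, hxa]⟩
  intro e' he'
  rw [mem_erase]
  refine ⟨?_, supp_subset_of_comp_of_le hcomp (hxa ▸ haz) he'⟩
  rintro rfl
  rw [mem_supp] at he'
  rw [he'] at hxe
  exact Bool.noConfusion hxe

/-- **Separating a vector from its lower neighbourhood costs a hit on the witnessing clique.** For `z` of weight
`b ≥ a`, the slice-`a` vectors comparable with (hence below) `z` on which `CLIQUE_k` differs from `CLIQUE_k(z)` number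
at most `C(k,2) · C(b - 1, a)`. [folklore] -/
theorem card_bad_nbhd_le {k a b : ℕ} (hab : a ≤ b) {z : Edge n → Bool} (hz : edgeCount z = b) :
    #((nbhd a z).filter fun x => cliqueFn n k x ≠ cliqueFn n k z) ≤ k.choose 2 * (b - 1).choose a := by
  cases hfz : cliqueFn n k z
  · -- no clique above: nothing below has one either
    have : (nbhd a z).filter (fun x => cliqueFn n k x ≠ false) = ∅ := by
      refine filter_eq_empty_iff.2 fun x hx hne => ?_
      rw [mem_nbhd] at hx
      have hsub : supp x ⊆ supp z := supp_subset_of_comp_of_le hx.2 (by rw [hx.1, hz]; exact hab)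
      have := cliqueFn_of_supp_subset (k := k) hsub (by simpa using hne)
      rw [hfz] at this
      exact Bool.noConfusion this
    rw [this, card_empty]
    exact Nat.zero_le _
  · obtain ⟨A, hA, hAz⟩ := exists_cliqueVec_le hfz
    set EA : Finset (Edge n) := univ.filter fun e => cliqueVec A e = true with hEA
    have hEAcard : #EA = k.choose 2 := by
      rw [hEA, card_filter_cliqueVec, (mem_powersetCard.1 hA).2]
    have hsub : (nbhd a z).filter (fun x => cliqueFn n k x ≠ true) ⊆
        EA.biUnion fun e => (nbhd a z).filter fun x => x e = false := by
      intro x hx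
      rw [mem_filter] at hx
      obtain ⟨hxn, hne⟩ := hx
      have hxf : cliqueFn n k x = false := by simpa using hne
      have : ¬ ∀ e, cliqueVec A e = true → x e = true := by
        intro h
        have := cliqueFn_of_cliqueVec_le hA h
        rw [hxf] at this
        exact Bool.noConfusion this
      push Not at this
      obtain ⟨e, heA, hxe⟩ := this
      rw [mem_biUnion]
      refine ⟨e, by rw [hEA, mem_filter]; exact ⟨mem_univ _, heA⟩, ?_⟩
      rw [mem_filter]
      exact ⟨hxn, by simpa using hxe⟩
    calc #((nbhd a z).filter fun x => cliqueFn n k x ≠ true)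
        ≤ #(EA.biUnion fun e => (nbhd a z).filter fun x => x e = false) := card_le_card hsub
      _ ≤ ∑ e ∈ EA, #((nbhd a z).filter fun x => x e = false) := card_biUnion_le
      _ ≤ ∑ e ∈ EA, (b - 1).choose a := sum_le_sum fun e he => by
          rw [← hz]
          exact card_nbhd_filter_false_le (hz ▸ hab) (hAz e (mem_filter.1 he).2)
      _ = k.choose 2 * (b - 1).choose a := by rw [sum_const, smul_eq_mul, hEAcard]

/-- Double counting of separating pairs (cardinality form). [folklore] -/
theorem sum_card_filter_nbhd_comm (i j : ℕ) (P : (Edge n → Bool) → (Edge n → Bool) → Prop)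
    [∀ x y, Decidable (P x y)] :
    ∑ y ∈ slice n i, (#((nbhd j y).filter fun x => P x y) : ℝ) =
      ∑ x ∈ slice n j, (#((nbhd i x).filter fun y => P x y) : ℝ) := by
  have h := sum_slice_sum_nbhd i j (fun x y => if P x y then (1 : ℝ) else 0)
  simp only [sum_boole] at h
  exact_mod_cast h

/-- **Separating pairs, lower slice `j ≤ i`**: summed over the slice `i`, at most `C(N,i)·C(k,2)·C(i-1,j)`. [folklore] -/
theorem sum_card_bad_le_of_le {i j k : ℕ} (hji : j ≤ i) :
    ∑ y ∈ slice n i, (#((nbhd j y).filter fun x => cliqueFn n k x ≠ cliqueFn n k y) : ℝ)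
      ≤ ((n.choose 2).choose i : ℝ) * ((k.choose 2 : ℝ) * ((i - 1).choose j : ℕ)) := by
  have : ∀ y ∈ slice n i, (#((nbhd j y).filter fun x => cliqueFn n k x ≠ cliqueFn n k y) : ℝ)
      ≤ (k.choose 2 : ℝ) * ((i - 1).choose j : ℕ) := fun y hy => by
    exact_mod_cast card_bad_nbhd_le hji (mem_filter.1 hy).2
  refine (sum_le_sum this).trans ?_
  rw [sum_const, nsmul_eq_mul, card_slice]

/-- **Separating pairs, upper slice `i ≤ j`**: summed over the slice `i` (by double counting, from the slice-`j` side),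
at most `C(N,j)·C(k,2)·C(j-1,i)`. [folklore] -/
theorem sum_card_bad_le_of_ge {i j k : ℕ} (hij : i ≤ j) :
    ∑ y ∈ slice n i, (#((nbhd j y).filter fun x => cliqueFn n k x ≠ cliqueFn n k y) : ℝ)
      ≤ ((n.choose 2).choose j : ℝ) * ((k.choose 2 : ℝ) * ((j - 1).choose i : ℕ)) := by
  refine (sum_card_filter_nbhd_comm i j (fun x y => cliqueFn n k x ≠ cliqueFn n k y)).trans_le ?_
  have : ∀ x ∈ slice n j, (#((nbhd i x).filter fun y => cliqueFn n k x ≠ cliqueFn n k y) : ℝ)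
      ≤ (k.choose 2 : ℝ) * ((j - 1).choose i : ℕ) := fun x hx => by
    rw [filter_congr (fun y _ => ne_comm)]
    exact_mod_cast card_bad_nbhd_le hij (mem_filter.1 hx).2
  refine (sum_le_sum this).trans ?_
  rw [sum_const, nsmul_eq_mul, card_slice]

/-- The binomial identity behind "the deleted edges hit a fixed clique", `C(b-1,a)·b = C(b,a)·(b-a)`, in the
inequality form used (`0 ≤ L ≤ b`). [folklore] -/
theorem choose_pred_mul_le {a b : ℕ} (hab : a ≤ b) {L : ℝ} (hL0 : 0 ≤ L) (hL : L ≤ b) :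
    (((b - 1).choose a : ℕ) : ℝ) * L ≤ (b.choose a : ℝ) * ((b : ℝ) - a) := by
  rcases Nat.eq_zero_or_pos b with rfl | hb
  · have ha : a = 0 := Nat.le_zero.1 hab
    subst ha
    simp only [Nat.cast_zero] at hL
    have hL' : L = 0 := le_antisymm hL hL0
    simp [hL']
  · obtain ⟨b', rfl⟩ : ∃ b', b = b' + 1 := ⟨b - 1, by omega⟩
    have hkey := Nat.choose_mul_succ_eq b' a
    have hkeyR : ((b'.choose a : ℕ) : ℝ) * ((b' : ℝ) + 1) = ((b' + 1).choose a : ℝ) * ((b' : ℝ) + 1 - a) := by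
      have := congrArg (Nat.cast (R := ℝ)) hkey
      push_cast [Nat.cast_sub hab] at this
      exact this
    rw [show b' + 1 - 1 = b' by omega]
    push_cast at hL ⊢
    calc ((b'.choose a : ℕ) : ℝ) * L ≤ ((b'.choose a : ℕ) : ℝ) * ((b' : ℝ) + 1) :=
          mul_le_mul_of_nonneg_left hL (Nat.cast_nonneg _)
      _ = ((b' + 1).choose a : ℝ) * ((b' : ℝ) + 1 - a) := hkeyR

/-- **Per-slice stability of `CLIQUE_k`.** For slices `i, j ≤ C(n,2)` of weight at least `L > 0`, the slice-`i` sum of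
the transport error of `𝟙[CLIQUE_k]` is at most `C(N,i) · C(k,2) · |i - j| / L`. [folklore] -/
theorem sliceSum_transport_clique_le {i j k : ℕ} (hi : i ≤ n.choose 2) (hj : j ≤ n.choose 2) {L : ℝ} (hL0 : 0 < L)
    (hLi : L ≤ i) (hLj : L ≤ j) :
    ∑ y ∈ slice n i, |transport j (ind (cliqueFn n k)) y - ind (cliqueFn n k) y|
      ≤ ((n.choose 2).choose i : ℝ) * (k.choose 2 * |(i : ℝ) - j| / L) := by
  set N := n.choose 2 with hN
  have hD := nbhdCard_pos hi hj
  have hD' : (0 : ℝ) < nbhdCard N i j := by exact_mod_cast hD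
  refine (sliceSum_abs_transport_ind_sub_ind_le (cliqueFn n k) hi hj).trans ?_
  rw [div_le_iff₀ hD']
  rcases le_total j i with hji | hij
  · -- lower slice: `D = C(i,j)` and `C(i-1,j)·L ≤ C(i,j)·(i-j)`
    have hDij : (nbhdCard N i j : ℝ) = (i.choose j : ℝ) := by rw [nbhdCard, if_pos hji]
    have habs : |(i : ℝ) - j| = (i : ℝ) - j := abs_of_nonneg (by simpa using (Nat.cast_le (α := ℝ)).2 hji)
    have hkey := choose_pred_mul_le hji hL0.le hLi
    refine (sum_card_bad_le_of_le (k := k) hji).trans ?_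
    rw [hDij, habs]
    have hCK : 0 ≤ ((N.choose i : ℕ) : ℝ) * (k.choose 2 : ℝ) := by positivity
    calc ((N.choose i : ℕ) : ℝ) * ((k.choose 2 : ℝ) * ((i - 1).choose j : ℕ))
        = ((N.choose i : ℕ) : ℝ) * (k.choose 2 : ℝ) * ((((i - 1).choose j : ℕ) : ℝ) * L) / L := by
          field_simp
      _ ≤ ((N.choose i : ℕ) : ℝ) * (k.choose 2 : ℝ) * ((i.choose j : ℝ) * ((i : ℝ) - j)) / L := by
          exact div_le_div_of_nonneg_right (mul_le_mul_of_nonneg_left hkey hCK) hL0.le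
      _ = ((N.choose i : ℕ) : ℝ) * (k.choose 2 * ((i : ℝ) - j) / L) * (i.choose j : ℝ) := by ring
  · -- upper slice: `C(N,i)·D = C(N,j)·C(j,i)` and `C(j-1,i)·L ≤ C(j,i)·(j-i)`
    have hrec : ((N.choose i : ℕ) : ℝ) * (nbhdCard N i j : ℝ) = (N.choose j : ℝ) * (j.choose i : ℝ) := by
      have := choose_mul_nbhdCard N i j
      rw [show nbhdCard N j i = j.choose i by rw [nbhdCard, if_pos hij]] at this
      exact_mod_cast this
    have habs : |(i : ℝ) - j| = (j : ℝ) - i := by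
      rw [abs_sub_comm]; exact abs_of_nonneg (by simpa using (Nat.cast_le (α := ℝ)).2 hij)
    have hkey := choose_pred_mul_le hij hL0.le hLj
    refine (sum_card_bad_le_of_ge (k := k) hij).trans ?_
    rw [habs]
    have hCK : 0 ≤ ((N.choose j : ℕ) : ℝ) * (k.choose 2 : ℝ) := by positivity
    calc ((N.choose j : ℕ) : ℝ) * ((k.choose 2 : ℝ) * ((j - 1).choose i : ℕ))
        = ((N.choose j : ℕ) : ℝ) * (k.choose 2 : ℝ) * ((((j - 1).choose i : ℕ) : ℝ) * L) / L := by
          field_simp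
      _ ≤ ((N.choose j : ℕ) : ℝ) * (k.choose 2 : ℝ) * ((j.choose i : ℝ) * ((j : ℝ) - i)) / L := by
          exact div_le_div_of_nonneg_right (mul_le_mul_of_nonneg_left hkey hCK) hL0.le
      _ = (k.choose 2 * ((j : ℝ) - i) / L) * (((N.choose j : ℕ) : ℝ) * (j.choose i : ℝ)) := by ring
      _ = ((N.choose i : ℕ) : ℝ) * (k.choose 2 * ((j : ℝ) - i) / L) * (nbhdCard N i j : ℝ) := by
          rw [← hrec]; ring

/-! ### Mixing over `G(n,p)`: the stability estimate -/

/-- **`L¹(G(n,p))` stability of `CLIQUE_k` under slice transport.** Let `j ≤ C(n,2)`. Suppose the edge counts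
`i ≤ C(n,2)` split into GOOD ones, of weight `≥ L > 0` and within `W` of `j`, and the others, at distance `≥ t > 0`
from the mean `C(n,2)·p`. Then `‖T_j𝟙[CLIQUE_k] − 𝟙[CLIQUE_k]‖_{L¹(G(n,p))} ≤ C(k,2)·W/L + C(n,2)p(1-p)/t²`. [folklore] -/
theorem l1_transport_clique_le {k j : ℕ} {p : ℝ} (hp0 : 0 ≤ p) (hp1 : p ≤ 1) (hj : j ≤ n.choose 2)
    (Good : ℕ → Prop) {L W t : ℝ} (hL0 : 0 < L) (hW : 0 ≤ W) (ht : 0 < t) (hLj : L ≤ j)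
    (hgood : ∀ i, Good i → L ≤ i ∧ |(i : ℝ) - j| ≤ W)
    (hbad : ∀ i, i ≤ n.choose 2 → ¬ Good i → t ≤ |(i : ℝ) - (n.choose 2 : ℕ) * p|) :
    l1 n p (transport j (ind (cliqueFn n k))) (ind (cliqueFn n k))
      ≤ k.choose 2 * W / L + (n.choose 2 : ℕ) * p * (1 - p) / t ^ 2 := by
  set N := n.choose 2 with hN
  set b : ℕ → ℝ := fun i => (N.choose i : ℝ) * p ^ i * (1 - p) ^ (N - i) with hbdef
  have hb : ∀ i, b i = (N.choose i : ℝ) * p ^ i * (1 - p) ^ (N - i) := fun i => rfl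
  set E : ℕ → ℝ := fun i =>
    ∑ y ∈ slice n i, |transport j (ind (cliqueFn n k)) y - ind (cliqueFn n k) y| with hE
  have hE0 : ∀ i, 0 ≤ E i := fun i => sum_nonneg fun y _ => abs_nonneg _
  -- every slice: `E i ≤ C(N,i)`; good slices: `E i ≤ C(N,i)·K W/L`
  have hEall : ∀ i, E i ≤ (N.choose i : ℝ) := fun i => by
    calc E i ≤ ∑ y ∈ slice n i, (1 : ℝ) :=
          sum_le_sum fun y _ => abs_transport_ind_sub_ind_le_one (cliqueFn n k) y
      _ = (N.choose i : ℝ) := by rw [sum_const, nsmul_eq_mul, mul_one, card_slice]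
  have hEgood : ∀ i, i ≤ N → Good i → E i ≤ (N.choose i : ℝ) * (k.choose 2 * W / L) := fun i hi hgi => by
    obtain ⟨hLi, hiW⟩ := hgood i hgi
    refine (sliceSum_transport_clique_le (k := k) hi hj hL0 hLi hLj).trans ?_
    refine mul_le_mul_of_nonneg_left ?_ (Nat.cast_nonneg _)
    exact div_le_div_of_nonneg_right (mul_le_mul_of_nonneg_left hiW (Nat.cast_nonneg _)) hL0.le
  have hq : ∀ i, 0 ≤ p ^ i * (1 - p) ^ (N - i) := fun i =>
    mul_nonneg (pow_nonneg hp0 _) (pow_nonneg (sub_nonneg.2 hp1) _)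
  rw [l1_eq_sum_slices]
  change ∑ i ∈ range (N + 1), p ^ i * (1 - p) ^ (N - i) * E i ≤ _
  rw [← sum_filter_add_sum_filter_not (range (N + 1)) Good]
  refine add_le_add ?_ ?_
  · -- good slices
    calc ∑ i ∈ (range (N + 1)).filter Good, p ^ i * (1 - p) ^ (N - i) * E i
        ≤ ∑ i ∈ (range (N + 1)).filter Good, b i * (k.choose 2 * W / L) := by
          refine sum_le_sum fun i hi => ?_
          obtain ⟨hir, hgi⟩ := mem_filter.1 hi
          have hiN : i ≤ N := Nat.lt_succ_iff.1 (mem_range.1 hir)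
          calc p ^ i * (1 - p) ^ (N - i) * E i ≤ p ^ i * (1 - p) ^ (N - i) * ((N.choose i : ℝ) * (k.choose 2 * W / L)) :=
                mul_le_mul_of_nonneg_left (hEgood i hiN hgi) (hq i)
            _ = b i * (k.choose 2 * W / L) := by rw [hb]; ring
      _ = (∑ i ∈ (range (N + 1)).filter Good, b i) * (k.choose 2 * W / L) := by rw [sum_mul]
      _ ≤ 1 * (k.choose 2 * W / L) := by
          refine mul_le_mul_of_nonneg_right ?_ (by positivity)
          calc ∑ i ∈ (range (N + 1)).filter Good, b i ≤ ∑ i ∈ range (N + 1), b i :=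
                sum_le_sum_of_subset_of_nonneg (filter_subset _ _) fun i _ _ => binomialWeight_nonneg hb hp0 hp1 i
            _ = 1 := binomialWeight_sum_range hb
      _ = k.choose 2 * W / L := one_mul _
  · -- far slices: Chebyshev
    calc ∑ i ∈ (range (N + 1)).filter (fun i => ¬ Good i), p ^ i * (1 - p) ^ (N - i) * E i
        ≤ ∑ i ∈ (range (N + 1)).filter (fun i => ¬ Good i), b i := by
          refine sum_le_sum fun i _ => ?_
          calc p ^ i * (1 - p) ^ (N - i) * E i ≤ p ^ i * (1 - p) ^ (N - i) * (N.choose i : ℝ) :=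
                mul_le_mul_of_nonneg_left (hEall i) (hq i)
            _ = b i := by rw [hb]; ring
      _ = ∑ i ∈ (range (N + 1)).filter (fun i => i ≤ N ∧ ¬ Good i), b i := by
          refine sum_congr (filter_congr fun i hi => ?_) fun _ _ => rfl
          have hiN : i ≤ N := Nat.lt_succ_iff.1 (mem_range.1 hi)
          exact ⟨fun h => ⟨hiN, h⟩, fun h => h.2⟩
      _ ≤ (N : ℝ) * p * (1 - p) / t ^ 2 :=
          binomialWeight_tail_le hb hp0 hp1 ht (fun i => i ≤ N ∧ ¬ Good i) fun i hi => hbad i hi.1 hi.2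

end

end Summit.PneNP.PneNP.Theorems.SliceTargetSplit


/-!
# Route OneSlice, crux `SliceTarget` (stmt-PneNP-2832) — split `SliceTarget ⟸ MonotoneContinuation ∧ SingleThreshold`,
# part III: the assembly

`sliceTarget_of_monotoneContinuation_of_singleThreshold :
   OneSlice.MonotoneContinuation → OneSlice.SingleThreshold → OneSlice.SliceTarget`.

Proof. Fix `c`; `MonotoneContinuation` gives `c'`; `SingleThreshold` at `c'` gives `k ≥ 3`, `δ_S > 0` and,
eventually, `err_{G(n,p)}(C') ≤ δ_S ⟹ n^{c'} < |C'|` for monotone `C'`; `MonotoneContinuation` at `(k, η := δ_S/3)`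
gives `ε > 0`. Put `δ := min (ε/2) (δ_S/3)`. Eventually in `n` (window + stability + both schedules), let `j` be
central and `C` a `{∧₂,∨₂}`-circuit with slice error `≤ δ·#slice_j`; suppose `|C| ≤ n^c`. With `T` the slice-`j`
transport (part I) and `κ = CLIQUE_k`:
`‖T𝟙[C] − T𝟙[κ]‖ ≤ δ` (contraction, part I) and `‖T𝟙[κ] − 𝟙[κ]‖ ≤ δ` (stability, part II; eventually), so the
MONOTONE function `κ` witnesses the continuation hypothesis (`‖𝟙[κ] − T𝟙[C]‖ ≤ 2δ ≤ ε`); `MonotoneContinuation`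
returns a monotone `C'` with `|C'| ≤ n^{c'}` and `‖𝟙[C'] − T𝟙[C]‖ ≤ δ_S/3`, whence
`err(C') = ‖𝟙[C'] − 𝟙[κ]‖ ≤ δ_S/3 + δ + δ ≤ δ_S` and `SingleThreshold` gives `n^{c'} < |C'| ≤ n^{c'}` — absurd.
Hence `n^c < |C|`.

The read-back `monotoneContinuation_iff` is `Iff.rfl` (the item's inline distance is `rdist`, which
`rdist_eq_l1` identifies with the `L¹(G(n,p_c))` distance to the transport of part I).
Strategist seat planner-cstrat-stmt-PneNP-2832-r1-0, 2026-08-17.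
-/

set_option linter.dupNamespace false -- `Summit.PneNP.PneNP.…`: summit = sub-problem (D-0017)

namespace Summit.PneNP.PneNP.Theorems.SliceTargetSplit

open Literature.Computability.Complexity hiding supp mem_supp
open Finset hiding slice
open Filter hiding mem_sdiff
open Classical
open Summit.PneNP.PneNP.Theorems.ConstantBand.Negative (Edge thr Central slice errSet)
open Summit.PneNP.PneNP.Theorems.SliceACZero.Negative (supp mem_supp card_supp supp_injective
  supp_indicator)
open Summit.PneNP.PneNP.Theorems.SingleThreshold.Negative (pc err LowerBoundAt singleThreshold_iff_lib tendsto_pc)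
open Summit.PneNP.PneNP.Theorems.SliceTarget.Negative (SliceLB sliceTarget_iff errSet_subset_slice)
open Summit.PneNP.PneNP.Theses.OneSlice (SliceTarget SingleThreshold MonotoneContinuation)

noncomputable section

/-! ### Read-back of the item `MonotoneContinuation` -/

/-- The item's inline `L¹(G(n,p_c))` distance between `𝟙[G]` and the slice-`j` transport of `𝟙[C]` (verbatim text). [folklore] -/
def rdist (n k j : ℕ) (C : Circuit (Edge n)) (G : (Edge n → Bool) → Bool) : ℝ :=
  (Finset.univ.sum (fun y : ((⊤ : SimpleGraph (Fin n)).edgeSet) → Bool => ((n : ℝ) ^ (-(2 : ℝ) / ((k : ℝ) - 1))) ^ (Finset.univ.filter (fun e => y e = true)).card * (1 - ((n : ℝ) ^ (-(2 : ℝ) / ((k : ℝ) - 1)))) ^ (n.choose 2 - (Finset.univ.filter (fun e => y e = true)).card) * |(if G y = true then (1 : ℝ) else 0) - ((Finset.univ.filter (fun x : ((⊤ : SimpleGraph (Fin n)).edgeSet) → Bool => (Finset.univ.filter (fun e => x e = true)).card = j ∧ ((∀ e, x e = true → y e = true) ∨ (∀ e, y e = true → x e = true)) ∧ C.eval x = true)).card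 : ℝ) / ((Finset.univ.filter (fun x : ((⊤ : SimpleGraph (Fin n)).edgeSet) → Bool => (Finset.univ.filter (fun e => x e = true)).card = j ∧ ((∀ e, x e = true → y e = true) ∨ (∀ e, y e = true → x e = true)))).card : ℝ)|))

/-- The item at fixed parameters `(c, c', k, η, ε)`. [folklore] -/
def ContAt (c c' k : ℕ) (η ε : ℝ) : Prop :=
  ∀ᶠ n : ℕ in atTop, ∀ j : ℕ, Central k n j → ∀ C : Circuit (Edge n), C.IsOver monotoneBasis → C.size ≤ n ^ c →
    (∃ F : (Edge n → Bool) → Bool, Monotone F ∧ rdist n k j C F ≤ ε) →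
    ∃ C' : Circuit (Edge n), C'.IsOver monotoneBasis ∧ C'.size ≤ n ^ c' ∧ rdist n k j C C'.eval ≤ η

/-- The item in schedule form: `∀ c ∃ c' ∀ k ≥ 3 ∀ η > 0 ∃ ε > 0, ContAt c c' k η ε`. [folklore] -/
def MonotoneContinuationSchedule : Prop :=
  ∀ c : ℕ, ∃ c' : ℕ, ∀ k : ℕ, 3 ≤ k → ∀ η : ℝ, 0 < η → ∃ ε : ℝ, 0 < ε ∧ ContAt c c' k η ε

/-- **Read-back.** The route item `MonotoneContinuation` (stmt-PneNP-18471) IS the schedule form, definitionally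
(its inline distance is `rdist`, its inline window is `Central`). [folklore] -/
theorem monotoneContinuation_iff : MonotoneContinuation ↔ MonotoneContinuationSchedule :=
  Iff.rfl

variable {n : ℕ}

/-- The item's denominator is the neighbourhood size. [folklore] -/
theorem filter_inline_eq_nbhd (j : ℕ) (y : Edge n → Bool) :
    (Finset.univ.filter (fun x : ((⊤ : SimpleGraph (Fin n)).edgeSet) → Bool => (Finset.univ.filter (fun e => x e = true)).card = j ∧ ((∀ e, x e = true → y e = true) ∨ (∀ e, y e = true → x e = true)))) = nbhd j y := by
  ext x
  simp only [Finset.mem_filter, Finset.mem_univ, true_and, mem_nbhd, Comp, edgeCount]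

/-- The item's numerator is the transported mass of `𝟙[C]`. [folklore] -/
theorem card_filter_inline_eq_sum (j : ℕ) (C : Circuit (Edge n)) (y : Edge n → Bool) :
    ((Finset.univ.filter (fun x : ((⊤ : SimpleGraph (Fin n)).edgeSet) → Bool => (Finset.univ.filter (fun e => x e = true)).card = j ∧ ((∀ e, x e = true → y e = true) ∨ (∀ e, y e = true → x e = true)) ∧ C.eval x = true)).card : ℝ)
      = ∑ x ∈ nbhd j y, ind C.eval x := by
  have h : (Finset.univ.filter (fun x : ((⊤ : SimpleGraph (Fin n)).edgeSet) → Bool => (Finset.univ.filter (fun e => x e = true)).card = j ∧ ((∀ e, x e = true → y e = true) ∨ (∀ e, y e = true → x e = true)) ∧ C.eval x = true))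
      = (nbhd j y).filter fun x => C.eval x = true := by
    ext x
    simp only [Finset.mem_filter, Finset.mem_univ, true_and, mem_nbhd, Comp, edgeCount, and_assoc]
  rw [h]
  unfold ind
  rw [sum_boole]

/-- `rdist` is the `L¹(G(n,p_c))` distance of part I between `𝟙[G]` and the transport of `𝟙[C]`. [folklore] -/
theorem rdist_eq_l1 (k j : ℕ) (C : Circuit (Edge n)) (G : (Edge n → Bool) → Bool) :
    rdist n k j C G = l1 n (pc n k) (ind G) (transport j (ind C.eval)) := by
  unfold rdist l1
  refine sum_congr rfl fun y _ => ?_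
  rw [card_filter_inline_eq_sum j C y, filter_inline_eq_nbhd j y]
  rfl

/-! ### Stability of `CLIQUE_k`, eventually -/

/-- **Eventually, the transport moves `CLIQUE_k` by at most `τ` in `L¹(G(n,p_c))`**, uniformly over central slices
(part II with `L = m - m^{3/4}`, `W = 2m^{3/4}`, `t = m^{3/4}/2`, `m = m_k(n) → ∞`). Also records `0 < p_c ≤ 1`
and `j ≤ C(n,2)` for central `j`. [folklore] -/
theorem eventually_stability {k : ℕ} (hk : 3 ≤ k) {τ : ℝ} (hτ : 0 < τ) :
    ∀ᶠ n : ℕ in atTop, 0 < pc n k ∧ pc n k ≤ 1 ∧ ∀ j : ℕ, Central k n j → j ≤ n.choose 2 ∧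
      l1 n (pc n k) (transport j (ind (cliqueFn n k))) (ind (cliqueFn n k)) ≤ τ := by
  set K : ℝ := ((k.choose 2 : ℕ) : ℝ) with hK
  have hK0 : 0 ≤ K := Nat.cast_nonneg _
  have hm : Tendsto (fun n : ℕ => (thr k n : ℝ)) atTop atTop :=
    tendsto_natCast_atTop_atTop.comp (tendsto_nat_floor_atTop.comp (tendsto_mean hk))
  have hA : Tendsto (fun n : ℕ => (thr k n : ℝ) ^ ((1 : ℝ) / 4)) atTop atTop :=
    (tendsto_rpow_atTop (by norm_num)).comp hm
  filter_upwards [eventually_window hk 0, hA.eventually_ge_atTop (max 2 ((4 * K + 8) / τ))]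
    with n hwin hAge
  obtain ⟨hp0, hp8, h34, h32, hwin5⟩ := hwin
  have hp1 : pc n k ≤ 1 := by linarith
  refine ⟨hp0, hp1, fun j hj => ?_⟩
  have hjN : j ≤ n.choose 2 := by simpa using central_add_le (w := 0) hp0 hp8 hwin5 hj
  refine ⟨hjN, ?_⟩
  -- the scales `m = A⁴`, `R = m^{3/4} = A³`
  set m : ℝ := (thr k n : ℝ) with hmdef
  set A : ℝ := m ^ ((1 : ℝ) / 4) with hAdef
  set R : ℝ := m ^ ((3 : ℝ) / 4) with hRdef
  have hm0 : 0 ≤ m := Nat.cast_nonneg _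
  have hA2 : 2 ≤ A := le_trans (le_max_left _ _) hAge
  have hAτ : (4 * K + 8) / τ ≤ A := le_trans (le_max_right _ _) hAge
  have hA0 : 0 < A := by linarith
  have hA1 : 1 ≤ A := by linarith
  have hmA : m = A ^ 4 := by
    rw [hAdef, ← Real.rpow_natCast, ← Real.rpow_mul hm0]; norm_num
  have hRA : R = A ^ 3 := by
    rw [hRdef, hAdef, ← Real.rpow_natCast, ← Real.rpow_mul hm0]; norm_num
  have hR2 : 2 ≤ R := h34
  have hR0 : 0 < R := by linarith
  have hmpos : 0 < m := by rw [hmA]; positivity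
  -- `2R ≤ m`
  have h2R : 2 * R ≤ m := by
    rw [hRA, hmA]
    nlinarith [pow_pos hA0 3]
  have hL0 : 0 < m - R := by linarith
  -- centrality of `j` and the mean
  have hjc := abs_le.1 hj
  have hμ0 : 0 ≤ ((n.choose 2 : ℕ) : ℝ) * pc n k := mul_nonneg (Nat.cast_nonneg _) hp0.le
  have hmμ : m ≤ ((n.choose 2 : ℕ) : ℝ) * pc n k := Nat.floor_le hμ0
  have hμm : ((n.choose 2 : ℕ) : ℝ) * pc n k < m + 1 := Nat.lt_floor_add_one _
  have hmain := l1_transport_clique_le (n := n) (k := k) hp0.le hp1 hjN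
    (fun i : ℕ => |(i : ℝ) - m| ≤ R) hL0 (by linarith : (0 : ℝ) ≤ 2 * R) (half_pos hR0)
    (by linarith [hjc.1])
    (fun i hi => by
      have := abs_le.1 hi
      refine ⟨by linarith [this.1], ?_⟩
      calc |(i : ℝ) - j| ≤ |(i : ℝ) - m| + |(m : ℝ) - j| := abs_sub_le _ _ _
        _ ≤ R + R := add_le_add hi (by rw [abs_sub_comm]; exact hj)
        _ = 2 * R := by ring)
    (fun i _ hi => by
      push Not at hi
      have h1 : |(i : ℝ) - m| ≤ |(i : ℝ) - (n.choose 2 : ℕ) * pc n k| + |((n.choose 2 : ℕ) : ℝ) * pc n k - m| :=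
        abs_sub_le _ _ _
      have h2 : |((n.choose 2 : ℕ) : ℝ) * pc n k - m| < 1 := by
        rw [abs_lt]; constructor <;> linarith
      linarith)
  refine hmain.trans ?_
  -- `K·2R/(m-R) + μ(1-p)/(R/2)² ≤ 4K/A + 8/A² ≤ (4K+8)/A ≤ τ`
  have hNp : ((n.choose 2 : ℕ) : ℝ) * pc n k * (1 - pc n k) ≤ m + 1 := by
    have : ((n.choose 2 : ℕ) : ℝ) * pc n k * (1 - pc n k) ≤ ((n.choose 2 : ℕ) : ℝ) * pc n k := by
      nlinarith [hμ0, hp0.le]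
    linarith
  have hterm1 : (k.choose 2 : ℝ) * (2 * R) / (m - R) ≤ 4 * K / A := by
    rw [← hK, div_le_div_iff₀ hL0 hA0, hRA, hmA]
    -- K·2A³·A ≤ 4K·(A⁴ - A³)  ⟸  2A⁴ ≤ 4A⁴ - 4A³ ⟸ 4A³ ≤ 2A⁴ ⟸ 2 ≤ A
    have hA3 : 0 < A ^ 3 := pow_pos hA0 3
    nlinarith [mul_nonneg hK0 hA3.le, hA2]
  have hterm2 : ((n.choose 2 : ℕ) : ℝ) * pc n k * (1 - pc n k) / (R / 2) ^ 2 ≤ 8 / A := by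
    have hR2pos : 0 < (R / 2) ^ 2 := by positivity
    rw [div_le_div_iff₀ hR2pos hA0]
    calc ((n.choose 2 : ℕ) : ℝ) * pc n k * (1 - pc n k) * A ≤ (m + 1) * A :=
          mul_le_mul_of_nonneg_right hNp hA0.le
      _ = (A ^ 4 + 1) * A := by rw [hmA]
      _ ≤ 8 * (R / 2) ^ 2 := by
          rw [hRA]
          have hA4 : 1 ≤ A ^ 4 := one_le_pow₀ hA1
          nlinarith [pow_pos hA0 2, pow_pos hA0 5, hA1, hA4]
  have hsum : 4 * K / A + 8 / A ≤ τ := by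
    rw [← add_div, div_le_iff₀ hA0]
    rw [div_le_iff₀ hτ] at hAτ
    linarith
  linarith [hterm1, hterm2, hsum]

/-! ### The assembly -/

/-- The slice-`j` error fraction of `C` against `CLIQUE_k`, as a counting sum. [folklore] -/
theorem sum_slice_abs_ind_eval_sub (k j : ℕ) (C : Circuit (Edge n)) :
    ∑ x ∈ slice n j, |ind C.eval x - ind (cliqueFn n k) x| = #(errSet n k j C) := by
  rw [sum_slice_abs_ind_sub_ind]
  congr 2
  ext x
  simp only [errSet, slice, mem_filter, mem_univ, true_and]

/-- **The split's assembly in schedule form: `MonotoneContinuationSchedule → SingleThreshold → SliceTarget`.**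
[folklore] -/
theorem sliceTarget_of_schedule_of_singleThreshold (hMC' : MonotoneContinuationSchedule)
    (hST : SingleThreshold) : SliceTarget := by
  rw [sliceTarget_iff]
  rw [singleThreshold_iff_lib] at hST
  intro c
  obtain ⟨c', hc'⟩ := hMC' c
  obtain ⟨k, hk, δS, hδS, hLB⟩ := hST c'
  obtain ⟨ε, hε, hCont⟩ := hc' k hk (δS / 3) (by positivity)
  set δ : ℝ := min (ε / 2) (δS / 3) with hδdef
  have hδ : 0 < δ := lt_min (by positivity) (by positivity)
  have hδε : δ ≤ ε / 2 := min_le_left _ _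
  have hδS3 : δ ≤ δS / 3 := min_le_right _ _
  refine ⟨k, hk, δ, hδ, ?_⟩
  unfold SliceLB
  filter_upwards [hCont, hLB, eventually_stability hk hδ] with n hContn hLBn hstab j hj C hC herr
  obtain ⟨hp0, hp1, hstab'⟩ := hstab
  obtain ⟨hjN, hstabj⟩ := hstab' j hj
  by_contra hlt
  push Not at hlt
  set p : ℝ := pc n k with hp
  set κ : (Edge n → Bool) → Bool := cliqueFn n k with hκ
  -- (s1) contraction: `‖T𝟙[C] − T𝟙[κ]‖ ≤ δ`
  have d1 : l1 n p (transport j (ind C.eval)) (transport j (ind κ)) ≤ δ := by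
    refine (l1_transport_le hp0.le hp1 j (ind C.eval) (ind κ)).trans ?_
    rw [sum_slice_abs_ind_eval_sub]
    rcases Nat.eq_zero_or_pos #(slice n j) with hs | hs
    · rw [hs, Nat.cast_zero, div_zero]; exact hδ.le
    · rw [div_le_iff₀ (by exact_mod_cast hs)]
      exact herr
  -- (s2) stability: `‖T𝟙[κ] − 𝟙[κ]‖ ≤ δ`
  have d2 : l1 n p (transport j (ind κ)) (ind κ) ≤ δ := hstabj
  -- (s3) the monotone witness `κ`
  have hF : ∃ F : (Edge n → Bool) → Bool, Monotone F ∧ rdist n k j C F ≤ ε := by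
    refine ⟨κ, cliqueFn_monotone_holds n k, ?_⟩
    rw [rdist_eq_l1]
    calc l1 n p (ind κ) (transport j (ind C.eval))
        ≤ l1 n p (ind κ) (transport j (ind κ)) + l1 n p (transport j (ind κ)) (transport j (ind C.eval)) :=
          l1_triangle hp0.le hp1 _ _ _
      _ ≤ δ + δ := add_le_add (by rw [l1_comm]; exact d2) (by rw [l1_comm]; exact d1)
      _ ≤ ε := by linarith
  -- (s4) the continuation `C'` is too accurate for `SingleThreshold`
  obtain ⟨C', hC', hsz', hd'⟩ := hContn j hj C hC hlt hF
  rw [rdist_eq_l1] at hd'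
  have herr' : err n k C' ≤ δS := by
    change gnpProb n p (univ.filter fun x => C'.eval x ≠ cliqueFn n k x) ≤ δS
    rw [← l1_ind_ind]
    calc l1 n p (ind C'.eval) (ind κ)
        ≤ l1 n p (ind C'.eval) (transport j (ind C.eval)) + l1 n p (transport j (ind C.eval)) (ind κ) :=
          l1_triangle hp0.le hp1 _ _ _
      _ ≤ δS / 3 + (l1 n p (transport j (ind C.eval)) (transport j (ind κ)) + l1 n p (transport j (ind κ)) (ind κ)) :=
          add_le_add hd' (l1_triangle hp0.le hp1 _ _ _)
      _ ≤ δS / 3 + (δ + δ) := by linarith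
      _ ≤ δS := by linarith
  exact absurd (hLBn C' hC' herr') (not_lt.2 hsz')

/-- **The split's assembly: `MonotoneContinuation → SingleThreshold → SliceTarget`** (route items by name). [folklore] -/
theorem sliceTarget_of_monotoneContinuation_of_singleThreshold (hMC : MonotoneContinuation)
    (hST : SingleThreshold) : SliceTarget :=
  sliceTarget_of_schedule_of_singleThreshold (monotoneContinuation_iff.1 hMC) hST

end

end Summit.PneNP.PneNP.Theorems.SliceTargetSplit
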